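import Mathlib
import Summits.ValiantsHypothesis.ValiantsHypothesis.Theorems.LacunarySymmetroidMatrixDescartesWLawTwoWitness

/-!
# `MatrixDescartes` (stmt-ValiantsHypothesis-18050) — kernel calibration: a SAME-SIDE letter beyond the doubled gap
# breaks `2·card ι`; the signed window's factor `2` is sharp to within `1/10`

HONEST FRAMING.  Cell `pub-symmetroid`, seat `val-sym-mdr-p2` (gen 5); helper file `--supports` the crux
`Theses.LacunarySymmetroid.MatrixDescartes`.  Two exact `2 × 2` witnesses (integer letters, `norm_num` sign
certificates at dyadic points) that CALIBRATE the tree's K-free two-sided laws; nothing here bears on the crux in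
its window, on `stub_twoSided` in general, on `DoorA26` / `DoorA34`, or on `VP ≠ VNP`.

CONTEXT.  The tree's K-free laws for pivot pencils `X^e J + ∑ X^{d_k} P_k` (`J` any symmetric, `P_k ⪰ 0`) are the
V-law (`stub_vLaw`: one PSD letter on each side, all gaps) and the signed fan laws (`…FanLaw`, `…FanLawTwo`,
`…FanLawThree/Four`): with a FACTORING letter at gap `a_f`, opposite-side letters need gap `≤ a_f` and same-side
letters need gap in `[a_f, 2a_f]` (`Z₊ ≤ 2·card ι`).  The recorded `> 2·card ι` witnesses (`not_wLaw_two`,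
`…RankOneWitness`, `DefiniteWitness.cameronPsarrakos_counterexample`) all offend through an OPPOSITE-side letter
beyond the factoring gap (seat memo SIGNED-FAN-LAW §3 listed «same-side letter beyond `2a_f` with the opposite
letter inside: NO DATA»).  This file supplies that datum in the kernel:

* `SameSideWitness.six_le_card_posRoots_Fa` — `F = P₀ + X J + X² P₁ + X⁴ P₂` (`P₀, P₁, P₂ ⪰ 0`, `J` indefinite):
  ONE letter below the pivot at gap `1`, letters above at gaps `1` and `3 = 3·1`; `det F` alternates in sign at
  `1/32 < 1/4 < 7/8 < 5/4 < 2 < 5 < 25`, so `Z₊ ≥ 6 = 3·2`.  Consequence `not_oneBelowLaw_two`: the natural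
  extension of the V-law «one PSD letter below the pivot at gap `a`, any PSD letters above at gaps `≥ a` ⇒
  `Z₊ ≤ 2·card ι`» (equivalently: `F/X^e = J + P₀/y + Σ y^{c_k}P_k`, `c_k ≥ 1`, LOEWNER-CONVEX with a single pole)
  is FALSE already at `card ι = 2`, `K = 4`.
* `SameSideWitness.six_le_card_posRoots_Fb` — `F = P₀ + X^{10} J + X^{20} P₁ + X^{31} P₂`: factoring letter `P₁`
  (gap `10`), opposite letter `P₀` at gap `10 = a_f` (closed boundary), same-side letter `P₂` at gap `21 = 2.1·a_f`;
  `det F` alternates at `1/8 < 1/2 < 3/4 < 53/64 < 15/16 < 17/16 < 3`, so `Z₊ ≥ 6`.  Consequence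
  `not_signedWindow_21_10`: the same-side window `[a_f, 2a_f]` of the signed fan law cannot be widened to
  `[a_f, 2.1·a_f]` — the factor `2` (the right end of the positivity range `γ ∈ [1,2]` of the second-divided-
  difference kernel of `w^γ`) is a property of the LAW, not only of the method, sharp to within `1/10`.

LOCATED REMARKS (numerics of this seat, n = 2, NOT kernel facts; zero-forcing in light-cone coordinates, ≈ 10⁵
trials): writing the gaps as `(−a; b₁, b₂)`, `a ≤ b₁ < b₂`, six positive zeros were found at `b₂/b₁ = 2.1` ONLY at
the exponent coincidence `a = b₁` (where `det J·X^{2e}` and `D(P₀,P₁)·X^{d₀+d₁}` share a monomial); for `a < b₁` the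
located threshold for six is `b₂/b₁ ≈ 2.7–2.9`, and the much-asked pattern `(−1; 2, 5)` (`(e−1 | e | e+2, e+5)`,
desk R1416/R1515) stayed at `4 = 2·2` in every run (Descartes allows 6) — so the true K-free window is wider than
the kernel-positivity window off the coincidence, by an amount this file does not determine.  For the W-shape
`(in, in, out, in)` no configuration with more than `6` positive zeros was found on the Descartes-8 supports
(`(0,4,6,11)`, `(0,3,5,9)`, `(0,5,8,15)`, `(0,7,9,17)`), consistent with the typed candidate `WLawAt 2 6`.

[folklore] Elementary; the sign patterns are `norm_num` certificates at rational points.  Mathlib plus the tree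
lemmas `le_card_posRoots_of_alternating`, `WLawTwoWitness.eval_det_pencil₄`,
`DefiniteWitness.posSemidef_vecMulVec_self` (axioms `propext`, `Classical.choice`, `Quot.sound`).
-/

-- `Summit.ValiantsHypothesis.ValiantsHypothesis.…` repeats a component by the single-conjunct
-- summit layout, which the `dupNamespace` linter flags; the name is mandated.
set_option linter.dupNamespace false

namespace Summit.ValiantsHypothesis.ValiantsHypothesis.Theorems.LacunarySymmetroidMatrixDescartes

open Summit.ValiantsHypothesis.ValiantsHypothesis.Theorems.SymmetroidDescartes
  (le_card_posRoots_of_alternating)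
open scoped BigOperators Matrix
open Polynomial

/-! ### Witness A: exponents `(0 | 1 | 2, 4)`, gaps `(−1; 1, 3)` -/

/-- the indefinite pivot letter `J = [[162480, 121387], [121387, −11124]]` (exponent `e = 1`) -/
local notation3 (prettyPrint := false) "Ja" =>
  (!![162480, 121387; 121387, -11124] : Matrix (Fin 2) (Fin 2) ℝ)

/-- the PSD letter below the pivot: `P₀ = v vᵀ + w wᵀ`, `v = (435, 3)`, `w = (0, 26)`
(`= [[189225, 1305], [1305, 685]]`, exponent `0`, gap `1`) -/
local notation3 (prettyPrint := false) "Pa₀" =>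
  (Matrix.vecMulVec ![(435 : ℝ), 3] ![(435 : ℝ), 3]
      + Matrix.vecMulVec ![(0 : ℝ), 26] ![(0 : ℝ), 26] : Matrix (Fin 2) (Fin 2) ℝ)

/-- the first PSD letter above the pivot: `P₁ = v vᵀ`, `v = (321, 355)` (`= [[103041, 113955], [113955, 126025]]`,
exponent `2`, gap `1`) -/
local notation3 (prettyPrint := false) "Pa₁" =>
  (Matrix.vecMulVec ![(321 : ℝ), 355] ![(321 : ℝ), 355] : Matrix (Fin 2) (Fin 2) ℝ)

/-- the second PSD letter above the pivot: `P₂ = v vᵀ`, `v = (120, 151)` (`= [[14400, 18120], [18120, 22801]]`,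
exponent `4`, gap `3` — three times the factoring gap) -/
local notation3 (prettyPrint := false) "Pa₂" =>
  (Matrix.vecMulVec ![(120 : ℝ), 151] ![(120 : ℝ), 151] : Matrix (Fin 2) (Fin 2) ℝ)

/-- witness A: `F(X) = X¹ • J + X⁰ • P₀ + X² • P₁ + X⁴ • P₂` -/
local notation3 (prettyPrint := false) "Fa" =>
  (((Polynomial.X : Polynomial ℝ) ^ 1) • (Ja).map Polynomial.C
    + ((Polynomial.X : Polynomial ℝ) ^ 0) • (Pa₀).map Polynomial.C
    + ((Polynomial.X : Polynomial ℝ) ^ 2) • (Pa₁).map Polynomial.C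
    + ((Polynomial.X : Polynomial ℝ) ^ 4) • (Pa₂).map Polynomial.C)

/-- seven positive test points `1/32 < 1/4 < 7/8 < 5/4 < 2 < 5 < 25` -/
local notation3 (prettyPrint := false) "τa" =>
  (![1/32, 1/4, 7/8, 5/4, 2, 5, 25] : Fin 7 → ℝ)

/-! ### Witness B: exponents `(0 | 10 | 20, 31)`, gaps `(−10; 10, 21)` -/

/-- the indefinite pivot letter `J = [[985976752, −1118168949], [−1118168949, −426167575]]` (exponent `e = 10`) -/
local notation3 (prettyPrint := false) "Jb" =>
  (!![985976752, -1118168949; -1118168949, -426167575] : Matrix (Fin 2) (Fin 2) ℝ)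

/-- the PSD letter below the pivot: `P₀ = v vᵀ + w wᵀ`, `v = (11112, −27165)`, `w = (0, 1)`
(`= [[123476544, −301857480], [−301857480, 737937226]]`, exponent `0`, gap `10`) -/
local notation3 (prettyPrint := false) "Pb₀" =>
  (Matrix.vecMulVec ![(11112 : ℝ), -27165] ![(11112 : ℝ), -27165]
      + Matrix.vecMulVec ![(0 : ℝ), 1] ![(0 : ℝ), 1] : Matrix (Fin 2) (Fin 2) ℝ)

/-- the factoring letter above the pivot: `P₁ = v vᵀ`, `v = (47364, 870)`
(`= [[2243348496, 41206680], [41206680, 756900]]`, exponent `20`, gap `10`) -/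
local notation3 (prettyPrint := false) "Pb₁" =>
  (Matrix.vecMulVec ![(47364 : ℝ), 870] ![(47364 : ℝ), 870] : Matrix (Fin 2) (Fin 2) ℝ)

/-- the offending same-side letter: `P₂ = v vᵀ`, `v = (34926, 4220)`
(`= [[1219825476, 147387720], [147387720, 17808400]]`, exponent `31`, gap `21 = 2.1·10`) -/
local notation3 (prettyPrint := false) "Pb₂" =>
  (Matrix.vecMulVec ![(34926 : ℝ), 4220] ![(34926 : ℝ), 4220] : Matrix (Fin 2) (Fin 2) ℝ)

/-- witness B: `F(X) = X¹⁰ • J + X⁰ • P₀ + X²⁰ • P₁ + X³¹ • P₂` -/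
local notation3 (prettyPrint := false) "Fb" =>
  (((Polynomial.X : Polynomial ℝ) ^ 10) • (Jb).map Polynomial.C
    + ((Polynomial.X : Polynomial ℝ) ^ 0) • (Pb₀).map Polynomial.C
    + ((Polynomial.X : Polynomial ℝ) ^ 20) • (Pb₁).map Polynomial.C
    + ((Polynomial.X : Polynomial ℝ) ^ 31) • (Pb₂).map Polynomial.C)

/-- seven positive test points `1/8 < 1/2 < 3/4 < 53/64 < 15/16 < 17/16 < 3` -/
local notation3 (prettyPrint := false) "τb" =>
  (![1/8, 1/2, 3/4, 53/64, 15/16, 17/16, 3] : Fin 7 → ℝ)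

namespace SameSideWitness

/-- `J` of witness A is symmetric -/
theorem Ja_isSymm : (Ja).IsSymm :=
  Matrix.IsSymm.ext fun i j => by fin_cases i <;> fin_cases j <;> simp

/-- `P₀ ⪰ 0` (witness A; a sum of two rank-one squares) -/
theorem Pa₀_posSemidef : (Pa₀).PosSemidef :=
  (DefiniteWitness.posSemidef_vecMulVec_self _).add (DefiniteWitness.posSemidef_vecMulVec_self _)

/-- `P₁ ⪰ 0` (witness A; a rank-one square) -/
theorem Pa₁_posSemidef : (Pa₁).PosSemidef := DefiniteWitness.posSemidef_vecMulVec_self _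

/-- `P₂ ⪰ 0` (witness A; a rank-one square) -/
theorem Pa₂_posSemidef : (Pa₂).PosSemidef := DefiniteWitness.posSemidef_vecMulVec_self _

/-- `det F(t)` of witness A in closed form -/
theorem eval_det_Fa (t : ℝ) :
    (Matrix.det Fa).eval t =
      (162480 * t ^ 1 + 189225 * t ^ 0 + 103041 * t ^ 2 + 14400 * t ^ 4) *
          (-11124 * t ^ 1 + 685 * t ^ 0 + 126025 * t ^ 2 + 22801 * t ^ 4) -
        (121387 * t ^ 1 + 1305 * t ^ 0 + 113955 * t ^ 2 + 18120 * t ^ 4) ^ 2 := by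
  rw [WLawTwoWitness.eval_det_pencil₄, Matrix.det_fin_two]
  simp only [Matrix.add_apply, Matrix.smul_apply, Matrix.vecMulVec_apply, smul_eq_mul]
  simp
  ring

/-- the test points of witness A increase -/
theorem τa_strictMono : StrictMono τa := by
  refine Fin.strictMono_iff_lt_succ.2 fun j => ?_
  fin_cases j <;> simp <;> norm_num

/-- the test points of witness A are positive -/
theorem τa_pos (j : Fin 7) : 0 < τa j := by
  fin_cases j <;> simp

/-- `det F` of witness A alternates in sign along the test points (signs `+,−,+,−,+,−,+`; a `norm_num`
certificate) -/
theorem alta (j : Fin 6) :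
    (Matrix.det Fa).eval (τa j.castSucc) * (Matrix.det Fa).eval (τa j.succ) < 0 := by
  fin_cases j <;> simp only [eval_det_Fa] <;> simp <;> norm_num

/-- **`Z₊ ≥ 6`** for witness A (`(0 | 1 | 2, 4)`: same-side letter at three times the gap). -/
theorem six_le_card_posRoots_Fa :
    6 ≤ ((Matrix.det Fa).roots.toFinset.filter (fun t => 0 < t)).card :=
  le_card_posRoots_of_alternating _ 6 τa τa_strictMono τa_pos alta

/-- `J` of witness B is symmetric -/
theorem Jb_isSymm : (Jb).IsSymm :=
  Matrix.IsSymm.ext fun i j => by fin_cases i <;> fin_cases j <;> simp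

/-- `P₀ ⪰ 0` (witness B) -/
theorem Pb₀_posSemidef : (Pb₀).PosSemidef :=
  (DefiniteWitness.posSemidef_vecMulVec_self _).add (DefiniteWitness.posSemidef_vecMulVec_self _)

/-- `P₁ ⪰ 0` (witness B) -/
theorem Pb₁_posSemidef : (Pb₁).PosSemidef := DefiniteWitness.posSemidef_vecMulVec_self _

/-- `P₂ ⪰ 0` (witness B) -/
theorem Pb₂_posSemidef : (Pb₂).PosSemidef := DefiniteWitness.posSemidef_vecMulVec_self _

/-- `det F(t)` of witness B in closed form -/
theorem eval_det_Fb (t : ℝ) :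
    (Matrix.det Fb).eval t =
      (985976752 * t ^ 10 + 123476544 * t ^ 0 + 2243348496 * t ^ 20 + 1219825476 * t ^ 31) *
          (-426167575 * t ^ 10 + 737937226 * t ^ 0 + 756900 * t ^ 20 + 17808400 * t ^ 31) -
        (-1118168949 * t ^ 10 + -301857480 * t ^ 0 + 41206680 * t ^ 20 + 147387720 * t ^ 31) ^ 2 := by
  rw [WLawTwoWitness.eval_det_pencil₄, Matrix.det_fin_two]
  simp only [Matrix.add_apply, Matrix.smul_apply, Matrix.vecMulVec_apply, smul_eq_mul]
  simp
  ring

/-- the test points of witness B increase -/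
theorem τb_strictMono : StrictMono τb := by
  refine Fin.strictMono_iff_lt_succ.2 fun j => ?_
  fin_cases j <;> simp <;> norm_num

/-- the test points of witness B are positive -/
theorem τb_pos (j : Fin 7) : 0 < τb j := by
  fin_cases j <;> simp

/-- `det F` of witness B alternates in sign along the test points (signs `+,−,+,−,+,−,+`; a `norm_num`
certificate) -/
theorem altb (j : Fin 6) :
    (Matrix.det Fb).eval (τb j.castSucc) * (Matrix.det Fb).eval (τb j.succ) < 0 := by
  fin_cases j <;> simp only [eval_det_Fb] <;> simp <;> norm_num

/-- **`Z₊ ≥ 6`** for witness B (`(0 | 10 | 20, 31)`: same-side letter at `2.1` times the factoring gap, opposite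
letter at the factoring gap). -/
theorem six_le_card_posRoots_Fb :
    6 ≤ ((Matrix.det Fb).roots.toFinset.filter (fun t => 0 < t)).card :=
  le_card_posRoots_of_alternating _ 6 τb τb_strictMono τb_pos altb

end SameSideWitness

open SameSideWitness

/-- **The one-below extension of the V-law is false at `n = 2`.**  It is NOT true that every `2 × 2` pivot pencil
`X^e J + X^{d₀} P₀ + X^{d₁} P₁ + X^{d₂} P₂` with `J` symmetric, `P₀, P₁, P₂ ⪰ 0`, ONE PSD letter below the pivot
(`d₀ < e`) and two above (`e < d₁ < d₂`) whose gaps are at least the lower gap (`e − d₀ ≤ d₁ − e`) has at most `2·2`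
distinct positive zeros of its determinant: witness A (`e = 1`, `(d₀, d₁, d₂) = (0, 2, 4)`) has at least `6`.
Equivalently: Loewner-convexity of `F/X^e = J + P₀ y⁻¹ + Σ y^{c_k} P_k` (`c_k ≥ 1`) with a single pole letter does
NOT bound the zero count by `2·card ι`. -/
theorem not_oneBelowLaw_two : ¬ ∀ (e d₀ d₁ d₂ : ℕ) (J P₀ P₁ P₂ : Matrix (Fin 2) (Fin 2) ℝ),
    J.IsSymm → P₀.PosSemidef → P₁.PosSemidef → P₂.PosSemidef → d₀ < e → e < d₁ → d₁ < d₂ → e - d₀ ≤ d₁ - e →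
    ((Matrix.det (((Polynomial.X : Polynomial ℝ) ^ e) • J.map Polynomial.C
        + ((Polynomial.X : Polynomial ℝ) ^ d₀) • P₀.map Polynomial.C
        + ((Polynomial.X : Polynomial ℝ) ^ d₁) • P₁.map Polynomial.C
        + ((Polynomial.X : Polynomial ℝ) ^ d₂) • P₂.map Polynomial.C)).roots.toFinset.filter
          (fun t => 0 < t)).card ≤ 2 * 2 := by
  intro h
  have h6 := six_le_card_posRoots_Fa.trans
    (h 1 0 2 4 Ja Pa₀ Pa₁ Pa₂ Ja_isSymm Pa₀_posSemidef Pa₁_posSemidef Pa₂_posSemidef (by norm_num) (by norm_num)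
      (by norm_num) (by norm_num))
  omega

/-- **The signed window cannot be widened by a tenth.**  It is NOT true that every `2 × 2` pivot pencil
`X^e J + X^{d₀} P₀ + X^{d₁} P₁ + X^{d₂} P₂` (`J` symmetric, `P₀, P₁, P₂ ⪰ 0`, `d₀ < e < d₁ < d₂`) whose opposite
letter is within the factoring gap (`e − d₀ ≤ d₁ − e`) and whose same-side letter is within `2.1` factoring gaps
(`10·(d₂ − e) ≤ 21·(d₁ − e)`) has at most `2·2` distinct positive zeros: witness B (`e = 10`,
`(d₀, d₁, d₂) = (0, 20, 31)`, gaps `(−10; 10, 21)`) has at least `6`.  The tree's signed fan laws prove `2·card ι`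
under `d₂ − e ≤ 2·(d₁ − e)` (with a definite companion on the closed boundary); so their factor `2` is sharp to
within `1/10`. -/
theorem not_signedWindow_21_10 : ¬ ∀ (e d₀ d₁ d₂ : ℕ) (J P₀ P₁ P₂ : Matrix (Fin 2) (Fin 2) ℝ),
    J.IsSymm → P₀.PosSemidef → P₁.PosSemidef → P₂.PosSemidef → d₀ < e → e < d₁ → d₁ < d₂ → e - d₀ ≤ d₁ - e →
    10 * (d₂ - e) ≤ 21 * (d₁ - e) →
    ((Matrix.det (((Polynomial.X : Polynomial ℝ) ^ e) • J.map Polynomial.C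
        + ((Polynomial.X : Polynomial ℝ) ^ d₀) • P₀.map Polynomial.C
        + ((Polynomial.X : Polynomial ℝ) ^ d₁) • P₁.map Polynomial.C
        + ((Polynomial.X : Polynomial ℝ) ^ d₂) • P₂.map Polynomial.C)).roots.toFinset.filter
          (fun t => 0 < t)).card ≤ 2 * 2 := by
  intro h
  have h6 := six_le_card_posRoots_Fb.trans
    (h 10 0 20 31 Jb Pb₀ Pb₁ Pb₂ Jb_isSymm Pb₀_posSemidef Pb₁_posSemidef Pb₂_posSemidef (by norm_num)
      (by norm_num) (by norm_num) (by norm_num) (by norm_num))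
  omega

end Summit.ValiantsHypothesis.ValiantsHypothesis.Theorems.LacunarySymmetroidMatrixDescartes
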